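import Summits.HodgeConjecture.HodgeConjecture.Theorems.F0P3cStCharTSLocalRingNormDictionary   -- ★ FILE 1 (this seat): the norm `nrm = Π_w |·|_w`, units, skew unit, modulus∕valuation dictionary
import HarnessLib

/-!
# F0 · P3c · line LH6 «StCharTS» — «LOCAL-RING NORM DICTIONARY AT A NON-SPLIT PLACE★», FILE 2: NULL SETS AND COMPACTNESS — points are Haar-null (so `nrm > 0` and
# `b ∈ Rˣ` a.e., on `R` and on the `σ`-fixed line), the norm balls `{nrm ≤ A}` and the Heisenberg chart annulus `{nrm (y − ½xσx) ≤ A}` are compact [WeilBNT1967 I §2; Rogawski1990 §1.10]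

Cell `pub/hodgecm-mathlib`, crux H413 = `stmt-HodgeConjecture-24833` (lane `--supports … --as helper`), route HCCMUnconditional; seat LH6-p04 (g10), twin of the
ROAD «KEYS3-ANALYTIC» holder F0P2-p06 (g21); FILE 2 of 2 of the «CM DICTIONARY» half of brick B6b of MEMO `F0/P2/F0P2-p06/g21/MEMO-KEYS3-analytic-road.v3` (FILE 1 = ★
`F0P3cStCharTSLocalRingNormDictionary`; split at the 400-line lint).  THEOREMS ONLY (0 def ∕ 0 instance ∕ 0 notation ∕ 0 sorry); ★-only imports.

WHAT.  `R = LocalRing L v = ∏_{w′ ∣ v} L_{w′}`, `σ = conjLocal`, `v` NON-SPLIT (`hw`), `nrm b := ∏ w′, normAbs (L_{w′}) (b w′)` written inline; binder spellings of ★ B3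
`F0P3cStCharTSHeisenbergAnnulusSlice.integral_annulus_heisZ_eq_zero_of_eigen_unit`:
* §1 null sets: **`measure_zero_eq_zero_of_isAddHaarMeasure`** (`μ {0} = 0` for EVERY additive Haar measure `μ` of `R`: scale the regular `addHaar` by a unit of modulus `< 1`,
  which fixes `{0}`, then Haar uniqueness on compacts, Mathlib `measure_isAddInvariant_eq_smul_of_isCompact_closure`), hence **`ae_prod_normAbs_pos`** (`hposR`, quantified over all Haar
  `μ` exactly as B3 binds it), **`ae_isUnit`** (`hunit`) and, on the `σ`-fixed line with its subspace Borel structure, **`ae_isUnit_fixedPart`** (`hunitp`; scaling by the fixed unit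
  `l = c₀ σ(c₀)`, ★ `HeisRing.map_smulFixed_eq`, `χ⁺(l)² = ‖l‖_R < 1` by ★ `fixedModulus_eq_skewModulus` ∕ `skewModulus_mul_self`);
* §2 compactness: `isCompact_setOf_valued_le` (valuation balls of `L_{w′}` — dilates of `𝒪_{w′}`, ★ `compactSpace_adicCompletionIntegers'`), `exists_valued_apply_le_of_prod_normAbs_le` (a norm bound is
  a valuation bound at the one place), **`isCompact_setOf_prod_normAbs_le`** (`hcptR`) and **`isCompact_setOf_prod_normAbs_heisZ_le`** (`hcpt`: `|x|_w² = |z + σz|_w ≤ |z|_w` and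
  `|y|_w ≤ max(1, |½|_w)·|z|_w` put the annulus in a compact valuation box; it is closed by continuity of `heisZ` and `nrm`).
HONEST LABEL: HC_CM is proved only modulo the 7 printed citations (2 remaining named inputs: hLiu418 = `stmt-HodgeConjecture-24832`, h413 = `stmt-HodgeConjecture-24833`) until
rung 0 closes; count-neutral dictionary (no node closes here).

## References
* [WeilBNT1967] A. Weil, *Basic Number Theory* (1967), Ch. I §2 (the module; compactness of balls in a local field).
* [Rogawski1990] J. D. Rogawski, *Automorphic Representations of Unitary Groups in Three Variables*, Ann. of Math. Stud. 123 (1990), §1.9 p. 8, §1.10 p. 9, §12.2 p. 173.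
* [TateThesis1967] J. Tate, *Fourier analysis in number fields and Hecke's zeta-functions*, in Cassels–Fröhlich (1967), §2.2 Lemma 2.2.5.
-/

set_option autoImplicit false
-- the mandated namespace has the single-problem summit's repeated segment (`HodgeConjecture.HodgeConjecture`)
set_option linter.dupNamespace false

noncomputable section

open NumberField IsDedekindDomain MeasureTheory Topology Filter
open scoped NNReal ENNReal Pointwise
open Literature.NumberTheory.Automorphic Literature.NumberTheory.Automorphic.UnitaryGroup
open Literature.NumberTheory.GaloisRepresentations Literature.NumberTheory.GaloisRepresentations.IsNonarchimedeanLocalField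
open Summit.HodgeConjecture.HodgeConjecture.Cruxes.H413.F0P3cStCharTSLocalRingNormDictionary

namespace Summit.HodgeConjecture.HodgeConjecture.Cruxes.H413.F0P3cStCharTSLocalRingNormCompactness

variable (L : Type) [Field L] [NumberField L] [IsCMField L] (v : HeightOneSpectrum (𝓞 ↥(maximalRealSubfield L)))
  (w : PlacesOver L v) (hw : IsCMField.complexConj L • w.1 = w.1)

/-! ## §1 Null sets: points are Haar-null, so `nrm > 0` and `b ∈ Rˣ` almost everywhere -/

include hw in
/-- **`μ {0} = 0` for EVERY additive Haar measure `μ` of `R`** (scale the regular `addHaar` by a unit of modulus `< 1`, which fixes `{0}`; transfer to `μ` by Haar uniqueness on compacts,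
Mathlib `measure_isAddInvariant_eq_smul_of_isCompact_closure`). [cite: WeilBNT1967, Ch. I §2] -/
theorem measure_zero_eq_zero_of_isAddHaarMeasure [MeasurableSpace (LocalRing L v)] [BorelSpace (LocalRing L v)]
    (μ : Measure (LocalRing L v)) [μ.IsAddHaarMeasure] : μ {0} = 0 := by
  haveI : Subsingleton (PlacesOver L v) :=
    PlacesOver.subsingleton_of_smul_eq (IsCMField.complexConj L) (IsCMField.complexConj_ne_one L) w hw
  -- a unit `c₀` of modulus `< 1` (the torus ray at `β` with `|β|_w = exp(-1)`)
  obtain ⟨β, hβ⟩ := IsDedekindDomain.HeightOneSpectrum.valuedAdicCompletion_surjective L w.1 (WithZero.exp (-1 : ℤ))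
  have hβ0 : β ≠ 0 := fun h0 => by rw [h0, map_zero] at hβ; exact WithZero.exp_ne_zero hβ.symm
  obtain ⟨t, ht⟩ := exists_torus_coe_localNonsplitEquiv_eq_diagonal L v w hw hβ0
  obtain ⟨hc₀, -⟩ := torusEntry_apply_eq_of_coe_localNonsplitEquiv_eq_diagonal L v w hw t ht
  set c₀ : (LocalRing L v)ˣ := torusEntry (conjLocal L (IsCMField.complexConj L) v) (cmLocalForm L 3 v) 0 t with hc₀def
  have hlt : unitModulusChar (LocalRing L v) c₀ < 1 :=
    unitModulusChar_lt_one_of_forall_v_lt_one L v c₀ fun w' => by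
      rw [Subsingleton.elim w' w, hc₀, hβ, ← WithZero.exp_zero, WithZero.exp_lt_exp]; norm_num
  -- the regular Haar measure `addHaar` gives `{0}` measure `0`: `‖c₀‖ · m = m` with `m < ⊤`, `‖c₀‖ ≠ 1`
  have h0 : (Measure.addHaar : Measure (LocalRing L v)) {0} = 0 := by
    have h := distribHaarChar_mul (Measure.addHaar : Measure (LocalRing L v)) c₀ ({0} : Set (LocalRing L v))
    rw [Set.smul_set_singleton, smul_zero] at h
    have hfin : (Measure.addHaar : Measure (LocalRing L v)) {0} ≠ ⊤ := (isCompact_singleton.measure_lt_top).ne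
    by_contra hne
    have hd : ((distribHaarChar (LocalRing L v) c₀ : ℝ≥0) : ℝ≥0∞) = 1 := by
      have h' : ((distribHaarChar (LocalRing L v) c₀ : ℝ≥0) : ℝ≥0∞) * (Measure.addHaar : Measure (LocalRing L v)) {0} =
          1 * (Measure.addHaar : Measure (LocalRing L v)) {0} := by rw [h, one_mul]
      exact (ENNReal.mul_left_inj hne hfin).1 h'
    have hd' : unitModulusChar (LocalRing L v) c₀ = 1 := by
      unfold unitModulusChar; exact_mod_cast hd
    exact (lt_irrefl (1 : ℝ≥0)) (hd' ▸ hlt)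
  -- Haar uniqueness on the compact `{0}`
  have h := Measure.measure_isAddInvariant_eq_smul_of_isCompact_closure μ (Measure.addHaar : Measure (LocalRing L v))
    (s := ({0} : Set (LocalRing L v))) (by rw [closure_singleton]; exact isCompact_singleton)
  rw [h, h0, smul_zero]

include hw in
/-- **`hposR`: `0 < nrm b` for `μ`-a.e. `b`, for every additive Haar measure `μ` of `R`** (the exceptional set is `{0}`) — B3's binder shape verbatim.
[cite: WeilBNT1967, Ch. I §2] [cite: TateThesis1967, §2.2 Lemma 2.2.5] -/
theorem ae_prod_normAbs_pos [MeasurableSpace (LocalRing L v)] [BorelSpace (LocalRing L v)] :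
    ∀ μ : Measure (LocalRing L v), μ.IsAddHaarMeasure →
      ∀ᵐ b ∂μ, 0 < ∏ w' : PlacesOver L v, normAbs (w'.1.adicCompletion L) (b w') := by
  intro μ hμ
  rw [ae_iff]
  refine measure_mono_null (fun b hb => ?_) (measure_zero_eq_zero_of_isAddHaarMeasure L v w hw μ)
  rw [Set.mem_setOf_eq, not_lt, nonpos_iff_eq_zero, prod_normAbs_eq_zero_iff L v w hw] at hb
  exact hb

include hw in
/-- **`hunit`: `μ`-a.e. `x` is a unit**, for every additive Haar measure `μ` of `R`. [cite: WeilBNT1967, Ch. I §2] -/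
theorem ae_isUnit [MeasurableSpace (LocalRing L v)] [BorelSpace (LocalRing L v)] (μ : Measure (LocalRing L v)) [μ.IsAddHaarMeasure] :
    ∀ᵐ x ∂μ, IsUnit x := by
  rw [ae_iff]
  refine measure_mono_null (fun x hx => ?_) (measure_zero_eq_zero_of_isAddHaarMeasure L v w hw μ)
  rw [Set.mem_setOf_eq, isUnit_iff_ne_zero_localRing L v w hw, not_not] at hx
  exact hx

include hw in
/-- **`hunitp`: `μ⁺`-a.e. `s ∈ R⁺` is a unit of `R`**, for every regular additive Haar measure `μ⁺` of the `σ`-fixed line `R⁺` (`μ⁺ {0} = 0`: scaling by a fixed unit `l` of modulus `≠ 1`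
multiplies `μ⁺` by `χ⁺(l)⁻¹` with `χ⁺(l)² = ‖l‖_R`, ★ `HeisRing.map_smulFixed_eq`, ★ `fixedModulus_eq_skewModulus`, ★ `skewModulus_mul_self`). [cite: WeilBNT1967, Ch. I §2] -/
theorem ae_isUnit_fixedPart [MeasurableSpace (LocalRing L v)] [BorelSpace (LocalRing L v)]
    (μp : Measure ↥(HeisRing.fixedPart (conjLocal L (IsCMField.complexConj L) v))) [μp.IsAddHaarMeasure] [μp.Regular] :
    ∀ᵐ s ∂μp, IsUnit ((s : ↥(HeisRing.fixedPart (conjLocal L (IsCMField.complexConj L) v))) : LocalRing L v) := by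
  haveI : Subsingleton (PlacesOver L v) :=
    PlacesOver.subsingleton_of_smul_eq (IsCMField.complexConj L) (IsCMField.complexConj_ne_one L) w hw
  haveI : SecondCountableTopology (LocalRing L v) := secondCountableTopology_localRing (E := L) v
  letI : Invertible (2 : LocalRing L v) := (isUnit_two_localRing L v).invertible
  have hσ := conjLocal_conjLocal_cm L v
  have hσc := continuous_conjLocal L (IsCMField.complexConj L) v
  haveI := HeisRing.locallyCompactSpace_fixedPart (conjLocal L (IsCMField.complexConj L) v) hσc
  -- a `σ`-fixed unit `l = c₀ σ(c₀)` of modulus `‖c₀‖² < 1`, and a skew unit `δ`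
  obtain ⟨β, hβ⟩ := IsDedekindDomain.HeightOneSpectrum.valuedAdicCompletion_surjective L w.1 (WithZero.exp (-1 : ℤ))
  have hβ0 : β ≠ 0 := fun h0 => by rw [h0, map_zero] at hβ; exact WithZero.exp_ne_zero hβ.symm
  obtain ⟨t, ht⟩ := exists_torus_coe_localNonsplitEquiv_eq_diagonal L v w hw hβ0
  obtain ⟨hc₀, -⟩ := torusEntry_apply_eq_of_coe_localNonsplitEquiv_eq_diagonal L v w hw t ht
  set c₀ : (LocalRing L v)ˣ := torusEntry (conjLocal L (IsCMField.complexConj L) v) (cmLocalForm L 3 v) 0 t with hc₀def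
  have hlt : unitModulusChar (LocalRing L v) c₀ < 1 :=
    unitModulusChar_lt_one_of_forall_v_lt_one L v c₀ fun w' => by
      rw [Subsingleton.elim w' w, hc₀, hβ, ← WithZero.exp_zero, WithZero.exp_lt_exp]; norm_num
  set l : (LocalRing L v)ˣ := c₀ * Units.map (conjLocal L (IsCMField.complexConj L) v : LocalRing L v →* LocalRing L v) c₀ with hl
  have hlfix : conjLocal L (IsCMField.complexConj L) v (l : LocalRing L v) = l := by
    rw [hl, Units.val_mul, Units.coe_map, MonoidHom.coe_coe, map_mul, hσ, mul_comm]
  have hl1 : distribHaarChar (LocalRing L v) l < 1 := by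
    rw [hl, map_mul, HeisRing.distribHaarChar_map_eq (conjLocal L (IsCMField.complexConj L) v) hσ hσc c₀]
    have h1 : distribHaarChar (LocalRing L v) c₀ < 1 := hlt
    calc distribHaarChar (LocalRing L v) c₀ * distribHaarChar (LocalRing L v) c₀
        ≤ distribHaarChar (LocalRing L v) c₀ * 1 := mul_le_mul_of_nonneg_left h1.le zero_le
      _ < 1 := by rw [mul_one]; exact h1
  obtain ⟨δ, hδ⟩ := exists_conjLocal_skew_unit L v
  -- `χ⁺(l)² = ‖l‖ < 1`, so `χ⁺(l) < 1`
  have hχsq : HeisRing.fixedModulus (conjLocal L (IsCMField.complexConj L) v) hσc l hlfix *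
      HeisRing.fixedModulus (conjLocal L (IsCMField.complexConj L) v) hσc l hlfix = distribHaarChar (LocalRing L v) l := by
    rw [HeisRing.fixedModulus_eq_skewModulus (conjLocal L (IsCMField.complexConj L) v) hσc δ hδ l hlfix]
    exact HeisRing.skewModulus_mul_self (conjLocal L (IsCMField.complexConj L) v) hσ hσc δ hδ l hlfix
  have hχ1 : HeisRing.fixedModulus (conjLocal L (IsCMField.complexConj L) v) hσc l hlfix < 1 := by
    by_contra hge
    rw [not_lt] at hge
    have : (1 : ℝ≥0) ≤ distribHaarChar (LocalRing L v) l := by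
      rw [← hχsq, ← one_mul (1 : ℝ≥0)]
      exact mul_le_mul' hge hge
    exact (not_lt.2 this) hl1
  have hχ0 := HeisRing.fixedModulus_pos (conjLocal L (IsCMField.complexConj L) v) hσc l hlfix
  -- `μp {0} = χ⁺(l)⁻¹ · μp {0}` with `μp {0} < ⊤`, hence `μp {0} = 0`
  have hmap := HeisRing.map_smulFixed_eq (conjLocal L (IsCMField.complexConj L) v) hσc l hlfix μp
  have h0 : μp {0} = 0 := by
    have hpre : (HeisRing.smulFixed (conjLocal L (IsCMField.complexConj L) v) l hlfix) ⁻¹'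
        ({0} : Set ↥(HeisRing.fixedPart (conjLocal L (IsCMField.complexConj L) v))) = {0} := by
      ext y
      simp only [Set.mem_preimage, Set.mem_singleton_iff]
      constructor
      · intro hy
        have hy' := congrArg (fun z : ↥(HeisRing.fixedPart (conjLocal L (IsCMField.complexConj L) v)) => (z : LocalRing L v)) hy
        simp only [HeisRing.coe_smulFixed, ZeroMemClass.coe_zero] at hy'
        exact Subtype.ext (by simpa using (Units.mul_right_eq_zero l).1 hy')
      · intro hy; rw [hy, map_zero]
    have hmeas : Measurable (HeisRing.smulFixed (conjLocal L (IsCMField.complexConj L) v) l hlfix) :=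
      (HeisRing.smulFixed (conjLocal L (IsCMField.complexConj L) v) l hlfix).continuous.measurable
    have h1 : μp {0} = ((HeisRing.fixedModulus (conjLocal L (IsCMField.complexConj L) v) hσc l hlfix)⁻¹ : ℝ≥0) • μp {0} := by
      have := congrArg (fun ν : Measure ↥(HeisRing.fixedPart (conjLocal L (IsCMField.complexConj L) v)) => ν {0}) hmap
      simp only [Measure.map_apply hmeas (measurableSet_singleton 0), hpre, Measure.coe_nnreal_smul_apply] at this
      rw [ENNReal.smul_def, smul_eq_mul]
      exact this
    have hfin : μp {0} ≠ ⊤ := (isCompact_singleton.measure_lt_top).ne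
    by_contra hne
    have h2 : (((HeisRing.fixedModulus (conjLocal L (IsCMField.complexConj L) v) hσc l hlfix)⁻¹ : ℝ≥0) : ℝ≥0∞) = 1 := by
      have h' : (((HeisRing.fixedModulus (conjLocal L (IsCMField.complexConj L) v) hσc l hlfix)⁻¹ : ℝ≥0) : ℝ≥0∞) * μp {0} = 1 * μp {0} := by
        rw [one_mul]; simpa only [ENNReal.smul_def, smul_eq_mul] using h1.symm
      exact (ENNReal.mul_left_inj hne hfin).1 h'
    have h3 : (HeisRing.fixedModulus (conjLocal L (IsCMField.complexConj L) v) hσc l hlfix)⁻¹ = 1 := by exact_mod_cast h2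
    rw [inv_eq_one] at h3
    exact (lt_irrefl (1 : ℝ≥0)) (h3 ▸ hχ1)
  rw [ae_iff]
  refine measure_mono_null (fun s hs => ?_) h0
  rw [Set.mem_setOf_eq, isUnit_iff_ne_zero_localRing L v w hw, not_not] at hs
  exact Subtype.ext hs

/-! ## §2 Compactness of the norm balls and of the chart annulus -/

omit [IsCMField L] in
/-- **Valuation balls of `L_{w′}` are compact**: `{x : v x ≤ γ}` is `{0}` for `γ = 0` and a dilate `a · 𝒪_{w′}` of the compact valuation ring otherwise
(★ `compactSpace_adicCompletionIntegers'`). [cite: WeilBNT1967, Ch. I §2] -/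
theorem isCompact_setOf_valued_le (w' : PlacesOver L v) (γ : WithZero (Multiplicative ℤ)) :
    IsCompact {x : w'.1.adicCompletion L | Valued.v x ≤ γ} := by
  by_cases hγ : γ = 0
  · have : {x : w'.1.adicCompletion L | Valued.v x ≤ γ} = {0} := by
      ext x
      simp only [Set.mem_setOf_eq, Set.mem_singleton_iff, hγ, le_zero_iff, map_eq_zero]
    rw [this]
    exact isCompact_singleton
  obtain ⟨a, ha⟩ := IsDedekindDomain.HeightOneSpectrum.valuedAdicCompletion_surjective L w'.1 γ
  have ha0 : a ≠ 0 := fun h0 => hγ (by rw [← ha, h0, map_zero])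
  have hO : IsCompact ((w'.1.adicCompletionIntegers L : Set (w'.1.adicCompletion L))) :=
    isCompact_iff_compactSpace.2 (compactSpace_adicCompletionIntegers' L w'.1)
  have hset : {x : w'.1.adicCompletion L | Valued.v x ≤ γ} = (fun y => a * y) '' (w'.1.adicCompletionIntegers L : Set (w'.1.adicCompletion L)) := by
    ext x
    simp only [Set.mem_setOf_eq, Set.mem_image, SetLike.mem_coe, IsDedekindDomain.HeightOneSpectrum.mem_adicCompletionIntegers]
    constructor
    · intro hx
      refine ⟨a⁻¹ * x, ?_, by rw [← mul_assoc, mul_inv_cancel₀ ha0, one_mul]⟩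
      rw [map_mul, map_inv₀, ha]
      calc γ⁻¹ * Valued.v x ≤ γ⁻¹ * γ := mul_le_mul' le_rfl hx
        _ = 1 := inv_mul_cancel₀ hγ
    · rintro ⟨y, hy, rfl⟩
      rw [map_mul, ha]
      calc γ * Valued.v y ≤ γ * 1 := mul_le_mul' le_rfl hy
        _ = γ := mul_one γ
  rw [hset]
  exact hO.image (continuous_const.mul continuous_id)

include hw in
/-- **A norm bound is a valuation bound at the one place above `v`**: for every `A` there is `x₀ ≠ 0` in `L_w` with `nrm b ≤ A ⇒ |b_w| ≤ |x₀|` (powers of an element of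
absolute value `> 1` exhaust `ℝ`; ★ `normAbs_le_normAbs_iff_valued`). [cite: WeilBNT1967, Ch. I §2] -/
theorem exists_valued_apply_le_of_prod_normAbs_le (A : ℝ) :
    ∃ x₀ : w.1.adicCompletion L, x₀ ≠ 0 ∧ ∀ b : LocalRing L v,
      ((∏ w' : PlacesOver L v, normAbs (w'.1.adicCompletion L) (b w') : ℝ≥0) : ℝ) ≤ A → Valued.v (b w) ≤ Valued.v x₀ := by
  haveI : Subsingleton (PlacesOver L v) :=
    PlacesOver.subsingleton_of_smul_eq (IsCMField.complexConj L) (IsCMField.complexConj_ne_one L) w hw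
  -- `y` with `|y|_w < 1`, `x₁ = y⁻¹` with `|x₁|_w > 1`
  obtain ⟨y, hy⟩ := IsDedekindDomain.HeightOneSpectrum.valuedAdicCompletion_surjective L w.1 (WithZero.exp (-1 : ℤ))
  have hy0 : y ≠ 0 := fun h0 => by rw [h0, map_zero] at hy; exact WithZero.exp_ne_zero hy.symm
  have hvy : Valued.v y < 1 := by rw [hy, ← WithZero.exp_zero, WithZero.exp_lt_exp]; norm_num
  have hny : normAbs (w.1.adicCompletion L) y < 1 := by
    refine lt_of_not_ge fun hle => ?_
    rw [← map_one (normAbs (w.1.adicCompletion L)), normAbs_le_normAbs_iff_valued, map_one] at hle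
    exact (not_le.2 hvy) hle
  have hny0 : 0 < normAbs (w.1.adicCompletion L) y := pos_iff_ne_zero.2 ((map_ne_zero _).2 hy0)
  have hx1 : 1 < ((normAbs (w.1.adicCompletion L) y⁻¹ : ℝ≥0) : ℝ) := by
    rw [map_inv₀]
    exact_mod_cast (one_lt_inv₀ hny0).2 hny
  obtain ⟨n, hn⟩ := pow_unbounded_of_one_lt A hx1
  refine ⟨(y⁻¹) ^ n, pow_ne_zero _ (inv_ne_zero hy0), fun b hb => ?_⟩
  rw [Fintype.prod_subsingleton _ w] at hb
  rw [← normAbs_le_normAbs_iff_valued, map_pow]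
  exact_mod_cast (hb.trans (le_of_lt hn))

include hw in
/-- **`hcptR`: `{b : nrm b ≤ A}` is compact** (at a non-split place it lies in a valuation box `Π_{w′} {v ≤ γ}` — compact, a dilate of `Π 𝒪_{w′}`, ★ `compactSpace_adicCompletionIntegers'` — and is closed).
[cite: WeilBNT1967, Ch. I §2] -/
theorem isCompact_setOf_prod_normAbs_le (A : ℝ) :
    IsCompact {b : LocalRing L v | ((∏ w' : PlacesOver L v, normAbs (w'.1.adicCompletion L) (b w') : ℝ≥0) : ℝ) ≤ A} := by
  haveI : Subsingleton (PlacesOver L v) :=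
    PlacesOver.subsingleton_of_smul_eq (IsCMField.complexConj L) (IsCMField.complexConj_ne_one L) w hw
  obtain ⟨x₀, -, hx₀⟩ := exists_valued_apply_le_of_prod_normAbs_le L v w hw A
  -- the valuation box `Π_{w′} {v ≤ v x₀}` is compact and contains the (closed) norm ball
  have hBox : IsCompact (Set.pi Set.univ fun w' : PlacesOver L v => {x : w'.1.adicCompletion L | Valued.v x ≤ Valued.v x₀}) :=
    isCompact_univ_pi fun w' => isCompact_setOf_valued_le L v w' _
  refine hBox.of_isClosed_subset (isClosed_le (NNReal.continuous_coe.comp (continuous_prod_normAbs L v)) continuous_const) ?_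
  intro b hb w' _
  obtain rfl : w' = w := Subsingleton.elim w' w
  exact hx₀ b hb

include hw in
/-- **`hcpt`: the chart annulus `{(x, y) ∈ R × R⁻ : nrm (y − ½ x σx) ≤ A}` is compact** (`z = heisZ x y`; `|x|_w² = |z + σz|_w ≤ |z|_w` by the skewness of `y`, `|y|_w ≤ max(1, |½|_w)·|z|_w`, so the
set sits in a compact box and is closed). [cite: Rogawski1990, §1.10 p. 9] [cite: WeilBNT1967, Ch. I §2] -/
theorem isCompact_setOf_prod_normAbs_heisZ_le [Invertible (2 : LocalRing L v)] (A : ℝ) :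
    IsCompact {p : LocalRing L v × ↥(HeisRing.skewPart (conjLocal L (IsCMField.complexConj L) v)) |
      ((∏ w' : PlacesOver L v, normAbs (w'.1.adicCompletion L)
        (HeisRing.heisZ (conjLocal L (IsCMField.complexConj L) v) p.1 (p.2 : LocalRing L v) w') : ℝ≥0) : ℝ) ≤ A} := by
  haveI : Subsingleton (PlacesOver L v) :=
    PlacesOver.subsingleton_of_smul_eq (IsCMField.complexConj L) (IsCMField.complexConj_ne_one L) w hw
  have hσ := conjLocal_conjLocal_cm L v
  have hσc := continuous_conjLocal L (IsCMField.complexConj L) v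
  obtain ⟨x₀, hx₀0, hx₀⟩ := exists_valued_apply_le_of_prod_normAbs_le L v w hw A
  -- the bounds: `γ = |x₀|_w` for `z`, `γx = exp (max (log γ) 0)` for `x`, `γy = max γ (|½|_w γ)` for `y`
  set γ : WithZero (Multiplicative ℤ) := Valued.v x₀ with hγ
  have hγ0 : γ ≠ 0 := (Valuation.ne_zero_iff _).2 hx₀0
  set c : WithZero (Multiplicative ℤ) := Valued.v ((⅟(2 : LocalRing L v)) w) with hcdef
  set γx : WithZero (Multiplicative ℤ) := WithZero.exp (max (WithZero.log γ) 0) with hγx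
  set γy : WithZero (Multiplicative ℤ) := max γ (c * γ) with hγy
  have hBox : IsCompact ((Set.pi Set.univ fun w' : PlacesOver L v => {x : w'.1.adicCompletion L | Valued.v x ≤ γx}) ×ˢ
      ((Subtype.val : ↥(HeisRing.skewPart (conjLocal L (IsCMField.complexConj L) v)) → LocalRing L v) ⁻¹'
        (Set.pi Set.univ fun w' : PlacesOver L v => {x : w'.1.adicCompletion L | Valued.v x ≤ γy}))) :=
    (isCompact_univ_pi fun w' => isCompact_setOf_valued_le L v w' _).prod
      ((HeisRing.isClosed_skewPart (conjLocal L (IsCMField.complexConj L) v) hσc).isClosedEmbedding_subtypeVal.isCompact_preimage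
        (isCompact_univ_pi fun w' => isCompact_setOf_valued_le L v w' _))
  -- the set is closed
  have hz : Continuous fun p : LocalRing L v × ↥(HeisRing.skewPart (conjLocal L (IsCMField.complexConj L) v)) =>
      HeisRing.heisZ (conjLocal L (IsCMField.complexConj L) v) p.1 (p.2 : LocalRing L v) := by
    unfold HeisRing.heisZ
    exact (continuous_subtype_val.comp continuous_snd).sub (continuous_const.mul (continuous_fst.mul (hσc.comp continuous_fst)))
  have hclosed : IsClosed {p : LocalRing L v × ↥(HeisRing.skewPart (conjLocal L (IsCMField.complexConj L) v)) |
      ((∏ w' : PlacesOver L v, normAbs (w'.1.adicCompletion L)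
        (HeisRing.heisZ (conjLocal L (IsCMField.complexConj L) v) p.1 (p.2 : LocalRing L v) w') : ℝ≥0) : ℝ) ≤ A} :=
    isClosed_le ((NNReal.continuous_coe.comp (continuous_prod_normAbs L v)).comp hz) continuous_const
  refine hBox.of_isClosed_subset hclosed ?_
  rintro ⟨x, y⟩ hp
  -- valuations at `w`: `|z|_w ≤ γ`, `|x|_w² = |z + σ z|_w ≤ |z|_w`, `y = z + ½ x σx`
  set z : LocalRing L v := HeisRing.heisZ (conjLocal L (IsCMField.complexConj L) v) x (y : LocalRing L v) with hzdef
  have hvz : Valued.v (z w) ≤ γ := hx₀ z hp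
  have hrel : z + conjLocal L (IsCMField.complexConj L) v z = -(x * conjLocal L (IsCMField.complexConj L) v x) :=
    HeisRing.heisZ_add_map (conjLocal L (IsCMField.complexConj L) v) hσ x y.2 (HeisRing.map_invOf_two _)
  have hxx : Valued.v (x w) * Valued.v (x w) ≤ Valued.v (z w) := by
    have hw' : x w * (conjLocal L (IsCMField.complexConj L) v x) w = -(z w + (conjLocal L (IsCMField.complexConj L) v z) w) := by
      have := congr_fun hrel w
      simp only [Pi.add_apply, Pi.neg_apply, Pi.mul_apply] at this
      linear_combination this
    calc Valued.v (x w) * Valued.v (x w)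
        = Valued.v (x w) * Valued.v ((conjLocal L (IsCMField.complexConj L) v x) w) := by rw [valued_conjLocal_apply_of_smul_eq L v w hw x]
      _ = Valued.v (-(z w + (conjLocal L (IsCMField.complexConj L) v z) w)) := by rw [← map_mul, hw']
      _ = Valued.v (z w + (conjLocal L (IsCMField.complexConj L) v z) w) := Valuation.map_neg _ _
      _ ≤ max (Valued.v (z w)) (Valued.v ((conjLocal L (IsCMField.complexConj L) v z) w)) := Valuation.map_add _ _ _
      _ = Valued.v (z w) := by rw [valued_conjLocal_apply_of_smul_eq L v w hw z, max_self]
  have hy_eq : (y : LocalRing L v) = z + ⅟(2 : LocalRing L v) * (x * conjLocal L (IsCMField.complexConj L) v x) := by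
    rw [hzdef, HeisRing.heisZ]; ring
  have hvx : Valued.v (x w) ≤ γx := by
    by_cases hx0 : Valued.v (x w) = 0
    · rw [hx0]; exact zero_le
    · have hz0 : Valued.v (z w) ≠ 0 := fun h0 => hx0 (by
        have := hxx; rw [h0, le_zero_iff, mul_self_eq_zero] at this; exact this)
      have e1 : WithZero.log (Valued.v (x w)) + WithZero.log (Valued.v (x w)) ≤ WithZero.log (Valued.v (z w)) := by
        rw [← WithZero.log_mul hx0 hx0]; exact (WithZero.log_le_log (mul_ne_zero hx0 hx0) hz0).2 hxx
      have e2 : WithZero.log (Valued.v (z w)) ≤ WithZero.log γ := (WithZero.log_le_log hz0 hγ0).2 hvz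
      rw [hγx]
      refine WithZero.le_exp_of_log_le ?_
      have := le_max_left (WithZero.log γ) 0
      have := le_max_right (WithZero.log γ) 0
      omega
  have hvy : Valued.v ((y : LocalRing L v) w) ≤ γy := by
    rw [hy_eq, Pi.add_apply, Pi.mul_apply, Pi.mul_apply]
    refine (Valuation.map_add _ _ _).trans (max_le_max hvz ?_)
    rw [map_mul, map_mul, valued_conjLocal_apply_of_smul_eq L v w hw x, ← hcdef]
    exact mul_le_mul' le_rfl (hxx.trans hvz)
  refine ⟨fun w' _ => ?_, fun w' _ => ?_⟩
  · obtain rfl : w' = w := Subsingleton.elim w' w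
    exact hvx
  · obtain rfl : w' = w := Subsingleton.elim w' w
    exact hvy

end Summit.HodgeConjecture.HodgeConjecture.Cruxes.H413.F0P3cStCharTSLocalRingNormCompactness

end
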